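import Literature.Probability.Percolation.SlabRSWHalfSide
import HarnessLib

/-!
# Newman–Tassion–Wu 2017, §3.3 — Proposition 3.9, item 1 (one step), linear form

Topic: `Literature/Probability/Percolation`. The RSW-type comparison of left-right crossing
probabilities of rectangles of the slab `S_k = ℤ² × {0,…,k}`,
`f_p(m,n) = P_p[L ⟷^{[0,m]×[0,n]} R]`: **`f_p(n + 2κn, n) ≥ h₂(f_p(n + κn, n))`**, obtained from the
gluing lemma GL0 (Thm. 3.6) twice. With the LINEAR form of GL0 proved in this series
(`glueLinear_rect_top'`, `glueLinear_seg_bottom_sides`: `P[A ⟷ B] P[C ⟷ D] ≤ K P[C ⟷ A]`) the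
function `h₂` is explicit: `h₂(x) = (x (1 - √(1-x)))² / (K₁² K₂)`.

* `slabConn_mono_sets`, `slabConn_subset_inter_target` — monotonicity / normalisation of the
  crossing events.
* `prop39_one_step` — PROVED: for `2 ≤ h`, `2h ≤ n ≤ 2h + 1`, `0 ≤ m`, `h + 4ρ + 8 < n + m`,
  `ρ ≥ 4`, `k ≥ 1`, `0 < p < 1`:
  `((1 - √(1 - f₁)) · f₁)² ≤ K₁² · K₂ · f₂`, where `f₁ = P_p[L ⟷ R in [0,n+m]×[0,n]]`,
  `f₂ = P_p[L ⟷ R in [-m,n+m]×[0,n]]`, `K₁ = 1 + λ^{3(5k+4)(12ρ+9)²}`,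
  `K₂ = 1 + λ^{3(5k+4)(12ρ+13)²}`, `λ = 2/min{p,1-p}` (translating, `f₂ = f_p(n+2m, n)`).

## Sources

* C. M. Newman, V. Tassion, W. Wu, *Critical percolation and the minimal spanning tree in slabs*,
  Comm. Pure Appl. Math. 70 (2017), arXiv:1512.09107: §3.3, Proposition 3.9 and its proof
  (`X = [0,n/2]×{0}`, `R = [0,n+κn]×[0,n]`, `R′ = [-κn,n+κn]×[0,n]`) [NewmanTassionWu2017].
-/

noncomputable section

namespace Literature.Probability.Percolation

open MeasureTheory LatticeModels SimpleGraph

namespace NTW17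

variable {k : ℕ}

/-- Crossing events are monotone in the domain and in both endpoint sets.
[cite: NewmanTassionWu2017, §3.3 ((3.8))] -/
theorem slabConn_mono_sets {B B' X X' Y Y' : Set (ℤ × ℤ)} (hB : B ⊆ B') (hX : X ⊆ X') (hY : Y ⊆ Y') :
    slabConn k B X Y ⊆ slabConn k B' X' Y' := by
  rintro ω ⟨x, hx, y, hy, hconn⟩
  exact ⟨x, slabLift_mono k hX hx, y, slabLift_mono k hY hy, openConnIn_mono (slabLift_mono k hB) _ _ hconn⟩

/-- The target of a crossing inside `B̄` may be intersected with `B`.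
[cite: NewmanTassionWu2017, §2.3 (Notation)] -/
theorem slabConn_subset_inter_target {B X Y : Set (ℤ × ℤ)} :
    slabConn k B X Y ⊆ slabConn k B X {z | z ∈ B ∧ z ∈ Y} := by
  intro ω hω
  obtain ⟨l, hl⟩ := (mem_slabConn_iff_exists_isOSAP ω _ _ _).1 hω
  refine (mem_slabConn_iff_exists_isOSAP ω _ _ _).2 ⟨l, ⟨hl.nodup, hl.chain, hl.subset, hl.ne_nil,
    hl.head_mem, fun h => ?_⟩⟩
  rw [mem_slabLift_iff]
  exact ⟨by have := hl.subset _ (List.getLast_mem h); rwa [mem_slabLift_iff] at this,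
    by have := hl.last_mem h; rwa [mem_slabLift_iff] at this⟩

/-- The source of a crossing inside `B̄` may be intersected with `B`.
[cite: NewmanTassionWu2017, §2.3 (Notation)] -/
theorem slabConn_subset_inter_source {B X Y : Set (ℤ × ℤ)} :
    slabConn k B X Y ⊆ slabConn k B {z | z ∈ B ∧ z ∈ X} Y := fun _ hω =>
  slabConn_comm (slabConn_subset_inter_target (slabConn_comm hω))

/-- **NTW 2017, Proposition 3.9, item 1, one step (`j = 2`), linear form.** With
`f₁ = P_p[L ⟷ R in [0,n+m]×[0,n]]` and `f₂ = P_p[L ⟷ R in [-m,n+m]×[0,n]]` (`= f_p(n+2m,n)` by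
translation): `((1 - √(1 - f₁)) · f₁)² ≤ K₁² · K₂ · f₂`. Proof: (1) the half-side square-root trick
in `S = [0,n]²` and `f_p(n,n) ≥ f₁` give `P[X ⟷^S T(S)] ≥ 1 - √(1 - f₁)` for `X = [0,h]×{0}`;
(2) GL0 in `R = [0,n+m]×[0,n]` glues it to `L(R) ⟷ R(R)`: `P[R(R) ⟷^R X] ≥ (1 - √(1-f₁)) f₁ / K₁`;
(3) GL0 in `R' = [-m,n+m]×[0,n]` glues `R(R') ⟷ X` to its mirror image `L(R') ⟷ Y`:
`f₂ ≥ P[R(R') ⟷ X]² / K₂`. [cite: NewmanTassionWu2017, §3.3 (Proposition 3.9 (1), proof)] -/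
theorem prop39_one_step (hk : 1 ≤ k) {ρ : ℕ} (hρ : 4 ≤ ρ) {n m h : ℤ} (hh : 2 ≤ h)
    (hn : 2 * h ≤ n) (hn' : n ≤ 2 * h + 1) (hm : 0 ≤ m) (hsep : h + 4 * ρ + 8 < n + m)
    (p : unitInterval) (hp0 : 0 < (p : ℝ)) (hp1 : (p : ℝ) < 1) :
    ((1 - Real.sqrt (1 - (bondPercolation (slabGraph 3 k) p).real
        (slabConn k (boxR 0 (n + m) 0 n) {z | z.1 = 0} {z | z.1 = n + m}))) *
        (bondPercolation (slabGraph 3 k) p).real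
          (slabConn k (boxR 0 (n + m) 0 n) {z | z.1 = 0} {z | z.1 = n + m})) ^ 2 ≤
      (1 + (2 / min (p : ℝ) (1 - p)) ^ (3 * ((5 * k + 4) * (2 * (6 * ρ + 4) + 1) ^ 2))) ^ 2 *
        (1 + (2 / min (p : ℝ) (1 - p)) ^ (3 * ((5 * k + 4) * (2 * (2 * (3 * ρ + 3)) + 1) ^ 2))) *
        (bondPercolation (slabGraph 3 k) p).real
          (slabConn k (boxR (-m) (n + m) 0 n) {z | z.1 = -m} {z | z.1 = n + m}) := by
  set P := bondPercolation (slabGraph 3 k) p with hP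
  set K₁ : ℝ := 1 + (2 / min (p : ℝ) (1 - p)) ^ (3 * ((5 * k + 4) * (2 * (6 * ρ + 4) + 1) ^ 2)) with hK₁
  set K₂ : ℝ := 1 + (2 / min (p : ℝ) (1 - p)) ^ (3 * ((5 * k + 4) * (2 * (2 * (3 * ρ + 3)) + 1) ^ 2))
    with hK₂
  have hK₁pos : 0 < K₁ := by positivity
  have hK₂pos : 0 < K₂ := by positivity
  -- the sets
  set R := boxR 0 (n + m) 0 n with hRdef
  set R' := boxR (-m) (n + m) 0 n with hR'def
  set S := boxR 0 n 0 n with hSdef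
  set X : Set (ℤ × ℤ) := {z | z.2 = 0 ∧ 0 ≤ z.1 ∧ z.1 ≤ h} with hXdef
  set f₁ := P.real (slabConn k R {z | z.1 = 0} {z | z.1 = n + m}) with hf₁
  set f₂ := P.real (slabConn k R' {z | z.1 = -m} {z | z.1 = n + m}) with hf₂
  have hf₁1 : f₁ ≤ 1 := measureReal_le_one
  have hf₁0 : 0 ≤ f₁ := measureReal_nonneg
  -- step 1: the half-side square-root trick in `S`, and `f(n,n) ≥ f₁`
  have h1 : 1 - Real.sqrt (1 - f₁) ≤ P.real (slabConn k R X {z | z ∈ R ∧ z.2 = n}) := by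
    have hsq := real_halfBottom_top_ge (k := k) (a := 0) (b := n) (c := 0) (d := n) (m := h) (by omega) p
    have hbt : P.real (slabConn k S {z | z.2 = 0} {z | z.2 = n}) =
        P.real (slabConn k (boxR 0 n 0 n) {z | z.1 = 0} {z | z.1 = n}) := real_bt_eq_lr 0 n 0 n p
    have hw : f₁ ≤ P.real (slabConn k (boxR 0 n 0 n) {z | z.1 = 0} {z | z.1 = n}) :=
      real_lr_wider_le (k := k) (a := 0) (b := n) (b' := n + m) (c := 0) (d := n) (by omega) (by omega) p
    have hmono : P.real (slabConn k S {z | z.2 = 0 ∧ 0 ≤ z.1 ∧ z.1 ≤ h} {z | z.2 = n}) ≤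
        P.real (slabConn k R X {z | z ∈ R ∧ z.2 = n}) := by
      refine measureReal_mono (fun ω hω => ?_)
      refine slabConn_mono_sets (B := R) subset_rfl subset_rfl (fun z hz => hz) ?_
      refine slabConn_subset_inter_target ?_
      exact slabConn_mono_sets (fun z hz => by rw [hSdef, mem_boxR_iff] at hz; rw [hRdef, mem_boxR_iff]; omega)
        subset_rfl subset_rfl hω
    calc 1 - Real.sqrt (1 - f₁) ≤ 1 - Real.sqrt (1 - P.real (slabConn k S {z | z.2 = 0} {z | z.2 = n})) := by
          rw [hbt]; gcongr
      _ ≤ _ := hsq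
      _ ≤ _ := hmono
  -- step 2: GL0 in `R`, target the top side, glued to `R(R) ⟷ L(R)`
  have h2 : (1 - Real.sqrt (1 - f₁)) * f₁ ≤ K₁ * P.real (slabConn k R {z | z ∈ R ∧ z.1 = n + m} X) := by
    have hgl := glueLinear_rect_top' (k := k) (a := 0) (b := n + m) (c := 0) (d := n) (by omega) (by omega)
      (A := X) (C := {z | z ∈ R ∧ z.1 = n + m}) (Dd := {z | z.1 = 0})
      (fun z hz => ⟨by rw [mem_boxR_iff]; simp only [hXdef, Set.mem_setOf_eq] at hz; omega, hz.1⟩)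
      (fun z hz => ⟨hz.1, hz.2⟩) (fun z hz => hz) hk (ρ := ρ) (by omega)
      (fun a' ha' c' hc' hmem => by
        simp only [hXdef, Set.mem_setOf_eq] at ha'
        have h1 := hc'.2
        rw [mem_sqBox_iff'] at hmem
        push_cast at hmem
        omega)
      p hp0 hp1
    -- `P[R(R) ⟷ L(R)] ≥ f₁`
    have hCD : f₁ ≤ P.real (slabConn k R {z | z ∈ R ∧ z.1 = n + m} {z | z.1 = 0}) := by
      refine measureReal_mono (fun ω hω => ?_)
      exact slabConn_subset_inter_source (slabConn_comm hω)
    have h0 : 0 ≤ 1 - Real.sqrt (1 - f₁) := by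
      rw [sub_nonneg, Real.sqrt_le_one]; linarith
    calc (1 - Real.sqrt (1 - f₁)) * f₁
        ≤ P.real (slabConn k R X {z | z ∈ R ∧ z.2 = n}) *
            P.real (slabConn k R {z | z ∈ R ∧ z.1 = n + m} {z | z.1 = 0}) := by gcongr
      _ ≤ _ := hgl
  -- step 3: GL0 in `R'`, bottom target `X`, glued to the mirror image
  have h3 : P.real (slabConn k R' {z | z ∈ R' ∧ z.1 = n + m} X) ^ 2 ≤ K₂ * f₂ := by
    set Y : Set (ℤ × ℤ) := {z | z.2 = 0 ∧ h ≤ z.1 ∧ z.1 ≤ n} with hYdef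
    have hgl := glueLinear_seg_bottom_sides (k := k) (a := -m) (b := n + m) (c := 0) (d := n) (x₁ := 0)
      (x₂ := h) (by omega) (by omega) (by omega) (by omega) (by omega)
      (A := {z | z ∈ R' ∧ z.1 = n + m}) (C := {z | z ∈ R' ∧ z.1 = -m}) (Y := Y)
      (fun z hz => hz) (fun z hz => hz) (fun z hz => ⟨hz.1, hz.2.1⟩) hk hρ
      (fun a' ha' c' hc' hmem => by
        have h1 := ha'.2; have h2 := hc'.2
        rw [mem_sqBox_iff'] at hmem
        push_cast at hmem
        omega)
      p hp0 hp1
    -- the mirror image: `P[L(R') ⟷ Y] ≥ P[R(R') ⟷ X]`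
    have hmirror : P.real (slabConn k R' {z | z ∈ R' ∧ z.1 = n + m} X) ≤
        P.real (slabConn k R' {z | z ∈ R' ∧ z.1 = -m} Y) := by
      have hg := planarAdj_planarReflect n
      have hS' : planarReflect n '' R' = R' := by
        have := image_planarReflect_boxR (-m) (n + m) 0 n
        rwa [show -m + (n + m) = n by ring] at this
      have hA' : planarReflect n '' {z | z ∈ R' ∧ z.1 = n + m} = {z | z ∈ R' ∧ z.1 = -m} := by
        rw [image_planarReflect_eq]; ext z
        simp only [Set.mem_setOf_eq, hR'def, mem_boxR_iff]; omega
      have hX' : planarReflect n '' X = {z | z.2 = 0 ∧ n - h ≤ z.1 ∧ z.1 ≤ n} := by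
        rw [image_planarReflect_eq]; ext z
        simp only [Set.mem_setOf_eq, hXdef]; omega
      have heq := real_slabConn_image k (planarReflect n) hg p R' {z | z ∈ R' ∧ z.1 = n + m} X
      rw [hS', hA', hX'] at heq
      rw [← heq]
      refine measureReal_mono (slabConn_mono_sets subset_rfl subset_rfl fun z hz => ?_)
      simp only [Set.mem_setOf_eq, hYdef] at hz ⊢; omega
    have hu0 : 0 ≤ P.real (slabConn k R' {z | z ∈ R' ∧ z.1 = n + m} X) := measureReal_nonneg
    have hf₂' : P.real (slabConn k R' {z | z ∈ R' ∧ z.1 = -m} {z | z ∈ R' ∧ z.1 = n + m}) ≤ f₂ :=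
      measureReal_mono (slabConn_mono_sets subset_rfl (fun z hz => hz.2) (fun z hz => hz.2))
    calc P.real (slabConn k R' {z | z ∈ R' ∧ z.1 = n + m} X) ^ 2
        = P.real (slabConn k R' {z | z ∈ R' ∧ z.1 = n + m} X) *
            P.real (slabConn k R' {z | z ∈ R' ∧ z.1 = n + m} X) := sq _
      _ ≤ P.real (slabConn k R' {z | z ∈ R' ∧ z.1 = n + m} X) *
            P.real (slabConn k R' {z | z ∈ R' ∧ z.1 = -m} Y) := by gcongr
      _ ≤ K₂ * P.real (slabConn k R' {z | z ∈ R' ∧ z.1 = -m} {z | z ∈ R' ∧ z.1 = n + m}) := hgl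
      _ ≤ K₂ * f₂ := by gcongr
  -- from `R` to `R'`
  have hRR' : P.real (slabConn k R {z | z ∈ R ∧ z.1 = n + m} X) ≤
      P.real (slabConn k R' {z | z ∈ R' ∧ z.1 = n + m} X) := by
    have hsub : R ⊆ R' := fun z hz => by
      rw [hRdef, mem_boxR_iff] at hz; rw [hR'def, mem_boxR_iff]; omega
    exact measureReal_mono (slabConn_mono_sets hsub (fun z hz => ⟨hsub hz.1, hz.2⟩) subset_rfl)
  -- assemble
  have hu : (1 - Real.sqrt (1 - f₁)) * f₁ ≤ K₁ * P.real (slabConn k R' {z | z ∈ R' ∧ z.1 = n + m} X) :=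
    h2.trans (by gcongr)
  have h0 : 0 ≤ (1 - Real.sqrt (1 - f₁)) * f₁ := by
    refine mul_nonneg ?_ hf₁0
    rw [sub_nonneg, Real.sqrt_le_one]; linarith
  calc ((1 - Real.sqrt (1 - f₁)) * f₁) ^ 2
      ≤ (K₁ * P.real (slabConn k R' {z | z ∈ R' ∧ z.1 = n + m} X)) ^ 2 := by gcongr
    _ = K₁ ^ 2 * P.real (slabConn k R' {z | z ∈ R' ∧ z.1 = n + m} X) ^ 2 := by rw [mul_pow]
    _ ≤ K₁ ^ 2 * (K₂ * f₂) := by gcongr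
    _ = K₁ ^ 2 * K₂ * f₂ := (mul_assoc _ _ _).symm

/-- **NTW 2017, Proposition 3.9, item 1, the induction step, linear form** (two widths): `R = [0,n+M]×[0,n]`, `R' = [-m,n+M]×[0,n]` with `0 ≤ m`, `2h + m ≤ n + M`. With
`f₁ = P_p[L ⟷ R in [0,n+m]×[0,n]]` and `f₂ = P_p[L ⟷ R in [-m,n+m]×[0,n]]` (`= f_p(n+2m,n)` by
translation): `((1 - √(1 - f₁)) · f₁)² ≤ K₁² · K₂ · f₂`. Proof: (1) the half-side square-root trick
in `S = [0,n]²` and `f_p(n,n) ≥ f₁` give `P[X ⟷^S T(S)] ≥ 1 - √(1 - f₁)` for `X = [0,h]×{0}`;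
(2) GL0 in `R = [0,n+m]×[0,n]` glues it to `L(R) ⟷ R(R)`: `P[R(R) ⟷^R X] ≥ (1 - √(1-f₁)) f₁ / K₁`;
(3) GL0 in `R' = [-m,n+m]×[0,n]` glues `R(R') ⟷ X` to its mirror image `L(R') ⟷ Y`:
`f₂ ≥ P[R(R') ⟷ X]² / K₂`. [cite: NewmanTassionWu2017, §3.3 (Proposition 3.9 (1), proof)] -/
theorem prop39_ind_step (hk : 1 ≤ k) {ρ : ℕ} (hρ : 4 ≤ ρ) {n m M h : ℤ} (hh : 2 ≤ h)
    (hn : 2 * h ≤ n) (hn' : n ≤ 2 * h + 1) (hm : 0 ≤ m) (hM : 0 ≤ M) (hmM : 2 * h + m ≤ n + M)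
    (hsep : h + 4 * ρ + 8 < n + M)
    (p : unitInterval) (hp0 : 0 < (p : ℝ)) (hp1 : (p : ℝ) < 1) :
    ((1 - Real.sqrt (1 - (bondPercolation (slabGraph 3 k) p).real
        (slabConn k (boxR 0 (n + M) 0 n) {z | z.1 = 0} {z | z.1 = n + M}))) *
        (bondPercolation (slabGraph 3 k) p).real
          (slabConn k (boxR 0 (n + M) 0 n) {z | z.1 = 0} {z | z.1 = n + M})) ^ 2 ≤
      (1 + (2 / min (p : ℝ) (1 - p)) ^ (3 * ((5 * k + 4) * (2 * (6 * ρ + 4) + 1) ^ 2))) ^ 2 *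
        (1 + (2 / min (p : ℝ) (1 - p)) ^ (3 * ((5 * k + 4) * (2 * (2 * (3 * ρ + 3)) + 1) ^ 2))) *
        (bondPercolation (slabGraph 3 k) p).real
          (slabConn k (boxR (-m) (n + M) 0 n) {z | z.1 = -m} {z | z.1 = n + M}) := by
  set P := bondPercolation (slabGraph 3 k) p with hP
  set K₁ : ℝ := 1 + (2 / min (p : ℝ) (1 - p)) ^ (3 * ((5 * k + 4) * (2 * (6 * ρ + 4) + 1) ^ 2)) with hK₁
  set K₂ : ℝ := 1 + (2 / min (p : ℝ) (1 - p)) ^ (3 * ((5 * k + 4) * (2 * (2 * (3 * ρ + 3)) + 1) ^ 2))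
    with hK₂
  have hK₁pos : 0 < K₁ := by positivity
  have hK₂pos : 0 < K₂ := by positivity
  -- the sets
  set R := boxR 0 (n + M) 0 n with hRdef
  set R' := boxR (-m) (n + M) 0 n with hR'def
  set S := boxR 0 n 0 n with hSdef
  set X : Set (ℤ × ℤ) := {z | z.2 = 0 ∧ 0 ≤ z.1 ∧ z.1 ≤ h} with hXdef
  set f₁ := P.real (slabConn k R {z | z.1 = 0} {z | z.1 = n + M}) with hf₁
  set f₂ := P.real (slabConn k R' {z | z.1 = -m} {z | z.1 = n + M}) with hf₂
  have hf₁1 : f₁ ≤ 1 := measureReal_le_one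
  have hf₁0 : 0 ≤ f₁ := measureReal_nonneg
  -- step 1: the half-side square-root trick in `S`, and `f(n,n) ≥ f₁`
  have h1 : 1 - Real.sqrt (1 - f₁) ≤ P.real (slabConn k R X {z | z ∈ R ∧ z.2 = n}) := by
    have hsq := real_halfBottom_top_ge (k := k) (a := 0) (b := n) (c := 0) (d := n) (m := h) (by omega) p
    have hbt : P.real (slabConn k S {z | z.2 = 0} {z | z.2 = n}) =
        P.real (slabConn k (boxR 0 n 0 n) {z | z.1 = 0} {z | z.1 = n}) := real_bt_eq_lr 0 n 0 n p
    have hw : f₁ ≤ P.real (slabConn k (boxR 0 n 0 n) {z | z.1 = 0} {z | z.1 = n}) :=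
      real_lr_wider_le (k := k) (a := 0) (b := n) (b' := n + M) (c := 0) (d := n) (by omega) (by omega) p
    have hmono : P.real (slabConn k S {z | z.2 = 0 ∧ 0 ≤ z.1 ∧ z.1 ≤ h} {z | z.2 = n}) ≤
        P.real (slabConn k R X {z | z ∈ R ∧ z.2 = n}) := by
      refine measureReal_mono (fun ω hω => ?_)
      refine slabConn_mono_sets (B := R) subset_rfl subset_rfl (fun z hz => hz) ?_
      refine slabConn_subset_inter_target ?_
      exact slabConn_mono_sets (fun z hz => by rw [hSdef, mem_boxR_iff] at hz; rw [hRdef, mem_boxR_iff]; omega)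
        subset_rfl subset_rfl hω
    calc 1 - Real.sqrt (1 - f₁) ≤ 1 - Real.sqrt (1 - P.real (slabConn k S {z | z.2 = 0} {z | z.2 = n})) := by
          rw [hbt]; gcongr
      _ ≤ _ := hsq
      _ ≤ _ := hmono
  -- step 2: GL0 in `R`, target the top side, glued to `R(R) ⟷ L(R)`
  have h2 : (1 - Real.sqrt (1 - f₁)) * f₁ ≤ K₁ * P.real (slabConn k R {z | z ∈ R ∧ z.1 = n + M} X) := by
    have hgl := glueLinear_rect_top' (k := k) (a := 0) (b := n + M) (c := 0) (d := n) (by omega) (by omega)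
      (A := X) (C := {z | z ∈ R ∧ z.1 = n + M}) (Dd := {z | z.1 = 0})
      (fun z hz => ⟨by rw [mem_boxR_iff]; simp only [hXdef, Set.mem_setOf_eq] at hz; omega, hz.1⟩)
      (fun z hz => ⟨hz.1, hz.2⟩) (fun z hz => hz) hk (ρ := ρ) (by omega)
      (fun a' ha' c' hc' hmem => by
        simp only [hXdef, Set.mem_setOf_eq] at ha'
        have h1 := hc'.2
        rw [mem_sqBox_iff'] at hmem
        push_cast at hmem
        omega)
      p hp0 hp1
    -- `P[R(R) ⟷ L(R)] ≥ f₁`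
    have hCD : f₁ ≤ P.real (slabConn k R {z | z ∈ R ∧ z.1 = n + M} {z | z.1 = 0}) := by
      refine measureReal_mono (fun ω hω => ?_)
      exact slabConn_subset_inter_source (slabConn_comm hω)
    have h0 : 0 ≤ 1 - Real.sqrt (1 - f₁) := by
      rw [sub_nonneg, Real.sqrt_le_one]; linarith
    calc (1 - Real.sqrt (1 - f₁)) * f₁
        ≤ P.real (slabConn k R X {z | z ∈ R ∧ z.2 = n}) *
            P.real (slabConn k R {z | z ∈ R ∧ z.1 = n + M} {z | z.1 = 0}) := by gcongr
      _ ≤ _ := hgl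
  -- step 3: GL0 in `R'`, bottom target `X`, glued to the mirror image
  have h3 : P.real (slabConn k R' {z | z ∈ R' ∧ z.1 = n + M} X) ^ 2 ≤ K₂ * f₂ := by
    set Y : Set (ℤ × ℤ) := {z | z.2 = 0 ∧ h ≤ z.1 ∧ z.1 ≤ n + M - m} with hYdef
    have hgl := glueLinear_seg_bottom_sides (k := k) (a := -m) (b := n + M) (c := 0) (d := n) (x₁ := 0)
      (x₂ := h) (by omega) (by omega) (by omega) (by omega) (by omega)
      (A := {z | z ∈ R' ∧ z.1 = n + M}) (C := {z | z ∈ R' ∧ z.1 = -m}) (Y := Y)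
      (fun z hz => hz) (fun z hz => hz) (fun z hz => ⟨hz.1, hz.2.1⟩) hk hρ
      (fun a' ha' c' hc' hmem => by
        have h1 := ha'.2; have h2 := hc'.2
        rw [mem_sqBox_iff'] at hmem
        push_cast at hmem
        omega)
      p hp0 hp1
    -- the mirror image: `P[L(R') ⟷ Y] ≥ P[R(R') ⟷ X]`
    have hmirror : P.real (slabConn k R' {z | z ∈ R' ∧ z.1 = n + M} X) ≤
        P.real (slabConn k R' {z | z ∈ R' ∧ z.1 = -m} Y) := by
      have hg := planarAdj_planarReflect (n + M - m)
      have hS' : planarReflect (n + M - m) '' R' = R' := by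
        have := image_planarReflect_boxR (-m) (n + M) 0 n
        rwa [show -m + (n + M) = n + M - m by ring] at this
      have hA' : planarReflect (n + M - m) '' {z | z ∈ R' ∧ z.1 = n + M} = {z | z ∈ R' ∧ z.1 = -m} := by
        rw [image_planarReflect_eq]; ext z
        simp only [Set.mem_setOf_eq, hR'def, mem_boxR_iff]; omega
      have hX' : planarReflect (n + M - m) '' X = {z | z.2 = 0 ∧ n + M - m - h ≤ z.1 ∧ z.1 ≤ n + M - m} := by
        rw [image_planarReflect_eq]; ext z
        simp only [Set.mem_setOf_eq, hXdef]; omega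
      have heq := real_slabConn_image k (planarReflect (n + M - m)) hg p R' {z | z ∈ R' ∧ z.1 = n + M} X
      rw [hS', hA', hX'] at heq
      rw [← heq]
      refine measureReal_mono (slabConn_mono_sets subset_rfl subset_rfl fun z hz => ?_)
      simp only [Set.mem_setOf_eq, hYdef] at hz ⊢; omega
    have hu0 : 0 ≤ P.real (slabConn k R' {z | z ∈ R' ∧ z.1 = n + M} X) := measureReal_nonneg
    have hf₂' : P.real (slabConn k R' {z | z ∈ R' ∧ z.1 = -m} {z | z ∈ R' ∧ z.1 = n + M}) ≤ f₂ :=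
      measureReal_mono (slabConn_mono_sets subset_rfl (fun z hz => hz.2) (fun z hz => hz.2))
    calc P.real (slabConn k R' {z | z ∈ R' ∧ z.1 = n + M} X) ^ 2
        = P.real (slabConn k R' {z | z ∈ R' ∧ z.1 = n + M} X) *
            P.real (slabConn k R' {z | z ∈ R' ∧ z.1 = n + M} X) := sq _
      _ ≤ P.real (slabConn k R' {z | z ∈ R' ∧ z.1 = n + M} X) *
            P.real (slabConn k R' {z | z ∈ R' ∧ z.1 = -m} Y) := by gcongr
      _ ≤ K₂ * P.real (slabConn k R' {z | z ∈ R' ∧ z.1 = -m} {z | z ∈ R' ∧ z.1 = n + M}) := hgl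
      _ ≤ K₂ * f₂ := by gcongr
  -- from `R` to `R'`
  have hRR' : P.real (slabConn k R {z | z ∈ R ∧ z.1 = n + M} X) ≤
      P.real (slabConn k R' {z | z ∈ R' ∧ z.1 = n + M} X) := by
    have hsub : R ⊆ R' := fun z hz => by
      rw [hRdef, mem_boxR_iff] at hz; rw [hR'def, mem_boxR_iff]; omega
    exact measureReal_mono (slabConn_mono_sets hsub (fun z hz => ⟨hsub hz.1, hz.2⟩) subset_rfl)
  -- assemble
  have hu : (1 - Real.sqrt (1 - f₁)) * f₁ ≤ K₁ * P.real (slabConn k R' {z | z ∈ R' ∧ z.1 = n + M} X) :=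
    h2.trans (by gcongr)
  have h0 : 0 ≤ (1 - Real.sqrt (1 - f₁)) * f₁ := by
    refine mul_nonneg ?_ hf₁0
    rw [sub_nonneg, Real.sqrt_le_one]; linarith
  calc ((1 - Real.sqrt (1 - f₁)) * f₁) ^ 2
      ≤ (K₁ * P.real (slabConn k R' {z | z ∈ R' ∧ z.1 = n + M} X)) ^ 2 := by gcongr
    _ = K₁ ^ 2 * P.real (slabConn k R' {z | z ∈ R' ∧ z.1 = n + M} X) ^ 2 := by rw [mul_pow]
    _ ≤ K₁ ^ 2 * (K₂ * f₂) := by gcongr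
    _ = K₁ ^ 2 * K₂ * f₂ := (mul_assoc _ _ _).symm

end NTW17

end Literature.Probability.Percolation
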